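import Literature.AlgebraicGeometry.AbelianSchemes.PolarizedLevelLocallyRigidifiable
import Literature.AlgebraicGeometry.AbelianSchemes.DualQuasiProjectiveOfPolarization
import Literature.AlgebraicGeometry.HodgeTheory.QuasiProjectiveOfFinite
import Literature.AlgebraicGeometry.Motives.GeneratingSectionsOfLocallyAmplePieces
import Literature.AlgebraicGeometry.Motives.GeneratingSectionsAlongOpenImmersion
import Literature.AlgebraicGeometry.Morphisms.ProjectiveSpaceOverBasePoints
import Literature.AlgebraicGeometry.ModuliOfAbelianVarieties.SiegelFineModuliScheme
import HarnessLib

/-!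
# The total space of a polarised abelian scheme over a quasi-projective base is quasi-projective (F-9 (9d))

Topic `Literature/AlgebraicGeometry/ModuliOfAbelianVarieties`; namespaces
`Literature.AlgebraicGeometry.AbelianSchemes.PolarizedAbelianSchemeWithLevel` and
`Literature.AlgebraicGeometry.ModuliOfAbelianVarieties.SiegelFineModuliScheme`.  THEOREMS ONLY (no definition, no named
fact, no instance, no notation, no `sorry`).

[MumfordFogartyKirwan1994] Ch. 7 §3, Thm. 7.9 (p. 139) / Thm. 7.10: the universal abelian scheme over the (quasi-projective)
fine moduli scheme `A_{g,d,n}` is quasi-projective.  In print this rides on Prop. 7.1 (descent of a relatively ample sheaf);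
here it is the elementary statement behind it, [EGAII] Prop. 4.6.13 (ii) / [Hartshorne1977] II Lemma 5.14 + Thm. 7.6: if
`π : X → M` carries a line bundle `𝓜` which embeds `X` into a projective space Zariski-locally over `M` and `M` is
quasi-projective over a field, then `𝓜 ⊗ π^*𝒪(e)` has, for `e ≫ 0`, global sections with AFFINE non-vanishing loci covering
`X`, so `X` is quasi-projective.  For a polarised abelian scheme `(A/M, λ)` with level structure over a locally Noetherian
`ℚ`-scheme the bundle is `𝓜 = L^Δ(λ)^{⊗3}`: its direct image is locally free of rank `6^g·d` (★
`PolarizedLevelLocallyRigidifiable.hasRank_pushforward_LDelta_three_of_compactSpace`, [MumfordFogartyKirwan1994] Prop. 6.13 /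
Def. 7.5) and every local frame of it embeds `A` (★ `Polarization.isClosedImmersion_pointOfSections_of_frame_LDelta_three`,
Prop. 7.6 / Lefschetz).  NO slice, Hilbert scheme or `𝐏(𝓔)` is named: the head is INTRINSIC.

Road (all inputs ★): `M` quasi-projective ⇒ an immersion `r : M ↪ 𝐏ⁿ_ℚ` and `M` compact; §1 finitely many forms `G_i` of
one degree with `M_{G_i} := r⁻¹ D₊(G_i)` AFFINE, covering `M`, each inside an open over which `π_*𝓜` is free (graded prime
avoidance with an open, the pattern of ★ `HodgeTheory/QuasiProjectiveOfFinite`); §2 the forms as coefficient data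
(`CocycleSections`, «`G_i / G_a`», ★ `formHomRatio`) on `X`; §3 over each piece `M_{G_i}` the frame, moved to the restricted
triple `Z|_{M_{G_i}}` (★ `pullbackFrame`, `pushforwardBaseChangeHom`, `nonempty_pullback_tensorPow_iso_of_isBaseChangeVia` —
the transport of ★ `exists_openImmersion_frame_LDelta_three`), embeds it as a closed subscheme of `𝐏^m × M_{G_i}` (★ FS-b), so
the frame sections have AFFINE non-vanishing loci (★ `projectiveSpace.isAffineOpen_U_of_isClosedImmersion_pointOfSections`)
covering the piece; ★ `GeneratingSections.exists_coeff_along_openImmersion_of_isAffineOpen` reads them on `X`; §4 the gluing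
lemma ★ `GeneratingSections.isQuasiProjectiveOver_of_affinePieces` («(G3)», Hartshorne II 5.14 uniformly) concludes.

* §1 `exists_form_mem_isAffineOpen_preimage_le`, `exists_forms_isAffineOpen_le_iSup_eq_top` (generic: immersions into
  `Proj 𝒜`, refining a given open neighbourhood of every point);
* §2 `exists_cocycleSections_of_forms` (generic: forms of one degree as `CocycleSections` on any scheme over `Proj 𝒜`);
* §3 `PolarizedAbelianSchemeWithLevel.exists_coeff_of_frame_piece` (the piece);
* §6 (edition 2) `compactSpace_of_isImmersion` (a scheme immersed in a quasi-compact locally Noetherian scheme is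
  quasi-compact) and `exists_forms_common_degree` (§1 for finitely many immersed quasi-compact pieces at once: forms of ONE
  common degree divisible by a prescribed `m`) — the inputs of the F-9 `hF9` closer;
* §4 **`PolarizedAbelianSchemeWithLevel.isQuasiProjectiveOver_total`** — THE HEAD: for a triple `Z` over a locally
  Noetherian `M : SchemeOver ℚ` with `IsQuasiProjectiveOver M` (and `IsPolarizationType δ`), the total space
  `Over.mk (Z.A.X.hom ≫ M.hom)` is quasi-projective over `ℚ`;
  **`SiegelFineModuliScheme.isQuasiProjectiveOver_univ`** — (F-c″) of ★ `SiegelFineModuliSchemeExists` from (F-c′), the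
  hypothesis of ★ `SiegelUniversalFamilyPieceQuasiProjective.isQuasiProjectiveOver_univ_piece` and of ★
  `SiegelFineModuliSchemeLevelDescent`; `…_univ_and_hat` adds the dual family (★ `isQuasiProjectiveOver_univ_hat`).

Cell `hodgecm-mathlib` (D-0151), F-9 (9d); count-neutral: HC_CM is proved only modulo the 7 printed citations until rung 0
closes — nothing here is about HC.

## References
* D. Mumford, J. Fogarty, F. Kirwan, *Geometric Invariant Theory*, 3rd ed. (1994), Ch. 7 §3 Thm. 7.9 (p. 139), Ch. 7 §2
  Def. 7.5 (p. 130), Prop. 7.6 (p. 136), Ch. 6 §2 Prop. 6.13 (p. 123). [MumfordFogartyKirwan1994]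
* A. Grothendieck, J. Dieudonné, *EGA II* (1961), Prop. 4.6.13 (ii), Thm. 4.5.2 and the remark following it, Prop. 5.3.4 (ii).
  [EGAII]
* R. Hartshorne, *Algebraic Geometry*, GTM 52 (1977), II Lemma 5.14 (p. 118), II Thm. 7.6 (p. 154), II Thm. 7.1. [Hartshorne1977]
* U. Görtz, T. Wedhorn, *Algebraic Geometry I*, 2nd ed. (2020), Prop. 13.47, Prop. 13.49 (pp. 392–393). [GortzWedhorn2020]
* B. Singh, *Basic Commutative Algebra* (2011), 2.9.2 (p. 39) (graded prime avoidance). [Singh2011]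
-/

noncomputable section

-- Mathlib's `Over`/pull-back API and `Scheme.Modules` section API are stated across semireducible wrappers.
set_option backward.isDefEq.respectTransparency false

universe u

open CategoryTheory CategoryTheory.Limits AlgebraicGeometry TopologicalSpace Opposite HomogeneousLocalization
open Literature.AlgebraicGeometry.Modules Literature.AlgebraicGeometry.Motives Literature.AlgebraicGeometry.Morphisms
open Literature.AlgebraicGeometry.Motives.GeneratingSections
open Literature.AlgebraicGeometry.HodgeTheory (IsQuasiProjectiveOver)

namespace Literature.AlgebraicGeometry.ModuliOfAbelianVarieties

namespace UniversalFamilyQuasiProjective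

/-! ## §1 Forms with affine non-vanishing loci refining an open neighbourhood of every point -/

section Forms

variable {A : Type u} {σ : Type*} [CommRing A] [SetLike σ A] [AddSubgroupClass σ A]
  (𝒜 : ℕ → σ) [GradedRing 𝒜] {Y : Scheme.{u}} (r : Y ⟶ Proj 𝒜) [IsImmersion r]

/-- **Every point of a scheme immersed in `Proj 𝒜` has, inside any given open neighbourhood `O`, an AFFINE neighbourhood
`r⁻¹ D₊(F)`**, `F` a form of positive degree: graded prime avoidance (★ `GradedPrimeAvoidance.exists_form_basicOpen`) on the
open `Ω := r.coborderRange ∩ O'` of `Proj 𝒜`, where `r(Y)` is closed in `r.coborderRange` and `r⁻¹ O' = O` (`r` is an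
embedding); `D₊(F)` is affine, hence so is its preimage under the closed immersion `Y ↪ Ω` (Görtz–Wedhorn I Prop. 13.49, the
pattern of ★ `HodgeTheory.exists_form_mem_isAffineOpen_preimage`). [cite: GortzWedhorn2020, Prop. 13.49 (p. 393)]
[cite: Singh2011, 2.9.2 (p. 39)] -/
theorem exists_form_mem_isAffineOpen_preimage_le (O : Y.Opens) (y : Y) (hy : y ∈ O) :
    ∃ (m : ℕ) (F : A), 0 < m ∧ F ∈ 𝒜 m ∧ y ∈ r ⁻¹ᵁ Proj.basicOpen 𝒜 F ∧
      IsAffineOpen (r ⁻¹ᵁ Proj.basicOpen 𝒜 F) ∧ r ⁻¹ᵁ Proj.basicOpen 𝒜 F ≤ O := by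
  classical
  -- an open `O'` of `Proj 𝒜` with `r⁻¹ O' = O`
  obtain ⟨O', hO'open, hO'⟩ := r.isEmbedding.isInducing.isOpen_iff.mp O.2
  let Ω : (Proj 𝒜).Opens := r.coborderRange ⊓ ⟨O', hO'open⟩
  have hΩ : ∀ t ∈ ({r y} : Finset ↥(Proj 𝒜)), t ∈ Ω := by
    intro t ht
    rw [Finset.mem_singleton] at ht
    subst ht
    refine ⟨subset_coborder ⟨y, rfl⟩, ?_⟩
    change y ∈ r.base ⁻¹' O'
    rw [hO']
    exact hy
  obtain ⟨m, F, hm, hF, hT, hle⟩ := GradedPrimeAvoidance.exists_form_basicOpen 𝒜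
    (𝟙 (Proj 𝒜)) Function.injective_id IsClosedMap.id {r y} Ω hΩ
  have hleΩ : Proj.basicOpen 𝒜 F ≤ Ω := by simpa using hle
  have hle' : Proj.basicOpen 𝒜 F ≤ r.coborderRange := hleΩ.trans inf_le_left
  refine ⟨m, F, hm, hF, ?_, ?_, ?_⟩
  · have hy' := hT (r y) (Finset.mem_singleton_self _)
    simpa using hy'
  · have hD : IsAffineOpen (Proj.basicOpen 𝒜 F) := Proj.isAffineOpen_basicOpen 𝒜 F hF hm
    have hV : IsAffineOpen (r.coborderRange.ι ⁻¹ᵁ Proj.basicOpen 𝒜 F) := by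
      rw [← r.coborderRange.ι.isAffineOpen_iff_of_isOpenImmersion,
        Scheme.Hom.image_preimage_eq_opensRange_inf, Scheme.Opens.opensRange_ι,
        inf_eq_right.mpr hle']
      exact hD
    have hpre : r.liftCoborder ⁻¹ᵁ (r.coborderRange.ι ⁻¹ᵁ Proj.basicOpen 𝒜 F) =
        r ⁻¹ᵁ Proj.basicOpen 𝒜 F := by
      rw [← Scheme.Hom.comp_preimage, Scheme.Hom.liftCoborder_ι]
    rw [← hpre]
    exact hV.preimage r.liftCoborder
  · intro x hx
    have hx' : r x ∈ Ω := hleΩ hx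
    have hx'' : x ∈ r.base ⁻¹' O' := hx'.2
    rw [hO'] at hx''
    exact hx''

/-- **Finitely many forms of ONE positive degree with AFFINE non-vanishing loci covering the quasi-compact `Y`, each inside
a prescribed open neighbourhood `O y` of some point** (finite subcover of the previous lemma, forms raised to the common degree
`d = ∏ deg` — `D₊(F^e) = D₊(F)`; [GortzWedhorn2020] Prop. 13.47 (i) ⇒ (iv) for the ample `r^*𝒪(1)`).
[cite: GortzWedhorn2020, Prop. 13.47 (pp. 392–393)] -/
theorem exists_forms_isAffineOpen_le_iSup_eq_top [CompactSpace Y] (O : Y → Y.Opens) (hO : ∀ y, y ∈ O y) :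
    ∃ (n d : ℕ) (G : Fin n → A) (c : Fin n → Y), 0 < d ∧ (∀ i, G i ∈ 𝒜 d) ∧
      (∀ i, IsAffineOpen (r ⁻¹ᵁ Proj.basicOpen 𝒜 (G i))) ∧ (∀ i, r ⁻¹ᵁ Proj.basicOpen 𝒜 (G i) ≤ O (c i)) ∧
      ⨆ i, r ⁻¹ᵁ Proj.basicOpen 𝒜 (G i) = ⊤ := by
  classical
  choose m F hm hF hy haff hle using fun y => exists_form_mem_isAffineOpen_preimage_le 𝒜 r (O y) y (hO y)
  obtain ⟨T, hT⟩ := isCompact_univ.elim_finite_subcover (fun y : Y ↦ (r ⁻¹ᵁ Proj.basicOpen 𝒜 (F y) : Set Y))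
    (fun y ↦ (r ⁻¹ᵁ Proj.basicOpen 𝒜 (F y)).2) (fun y _ ↦ Set.mem_iUnion.mpr ⟨y, hy y⟩)
  set d : ℕ := ∏ y ∈ T, m y with hd
  have hd0 : 0 < d := Finset.prod_pos fun y _ ↦ hm y
  have hdvd : ∀ y ∈ T, m y ∣ d := fun y hyT ↦ Finset.dvd_prod_of_mem m hyT
  set e := T.equivFin with he
  have hpow : ∀ i : Fin T.card, Proj.basicOpen 𝒜 (F (e.symm i) ^ (d / m (e.symm i))) =
      Proj.basicOpen 𝒜 (F (e.symm i)) := fun i =>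
    Proj.basicOpen_pow 𝒜 _ _ (Nat.div_pos (Nat.le_of_dvd hd0 (hdvd _ (e.symm i).2)) (hm _))
  refine ⟨T.card, d, fun i ↦ F (e.symm i) ^ (d / m (e.symm i)), fun i => (e.symm i).1, hd0, fun i ↦ ?_, fun i ↦ ?_,
    fun i => ?_, ?_⟩
  · have h := SetLike.pow_mem_graded (d / m (e.symm i).1) (hF (e.symm i))
    rwa [smul_eq_mul, Nat.div_mul_cancel (hdvd _ (e.symm i).2)] at h
  · rw [hpow]; exact haff _
  · rw [hpow]; exact hle _
  · rw [← top_le_iff]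
    intro y _
    have hyU : y ∈ ⋃ z ∈ T, (r ⁻¹ᵁ Proj.basicOpen 𝒜 (F z) : Set Y) := hT (Set.mem_univ y)
    obtain ⟨z, hzT, hyz⟩ := Set.mem_iUnion₂.mp hyU
    refine Opens.mem_iSup.mpr ⟨e ⟨z, hzT⟩, ?_⟩
    rw [hpow]
    simpa [Equiv.symm_apply_apply] using hyz

end Forms

/-! ## §2 Forms of one degree as coefficient data (`CocycleSections`) -/

section CocycleOfForms

variable {A : Type u} {σ : Type*} [CommRing A] [SetLike σ A] [AddSubgroupClass σ A]
  (𝒜 : ℕ → σ) [GradedRing 𝒜] {X : Scheme.{u}} (φ : X ⟶ Proj 𝒜) {n d : ℕ} (G : Fin n → A)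
  (hG : ∀ i, G i ∈ 𝒜 d) (hd : 0 < d)

/-- Two two-step restrictions between the same opens agree. [folklore] -/
private theorem map_map_irrel {U B B' C : X.Opens} (g : op U ⟶ op B) (f : op B ⟶ op C) (g' : op U ⟶ op B')
    (f' : op B' ⟶ op C) (s : Γ(X, U)) :
    X.presheaf.map f (X.presheaf.map g s) = X.presheaf.map f' (X.presheaf.map g' s) := by
  simp only [← CategoryTheory.comp_apply, ← Functor.map_comp]
  rw [Quiver.Hom.unop_inj (Subsingleton.elim (g ≫ f).unop (g' ≫ f').unop)]

/-- A single restriction equals a two-step one between the same opens. [folklore] -/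
private theorem map_eq_map_map {U B C : X.Opens} (f : op U ⟶ op C) (g : op U ⟶ op B) (f' : op B ⟶ op C) (s : Γ(X, U)) :
    X.presheaf.map f s = X.presheaf.map f' (X.presheaf.map g s) := by
  rw [← CategoryTheory.comp_apply, ← Functor.map_comp,
    Quiver.Hom.unop_inj (Subsingleton.elim f.unop (g ≫ f').unop)]

include hG hd in
/-- **Forms of one degree as `CocycleSections`**: on the opens `W a := φ⁻¹ D₊(G_a)` the coefficients `G_i / G_a` (★
`formHomRatio`) of the sections `φ^* G_i` of `φ^*𝒪(d)`, with the unit cocycle `G_a / G_b` (cocycle identity ★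
`formHomRatio_mul_formHomRatio`); the non-vanishing locus of `φ^* G_i` is `φ⁻¹ D₊(G_i)` (★ `basicOpen_formHomRatio`).
Hartshorne II Thm. 7.1 (a) for `φ` followed by the morphism the `G_i` define. [cite: Hartshorne1977, II Thm. 7.1] -/
theorem exists_cocycleSections_of_forms (hcov : ⨆ a, φ ⁻¹ᵁ Proj.basicOpen 𝒜 (G a) = ⊤) :
    ∃ S : CocycleSections (Fin n) (fun a => φ ⁻¹ᵁ Proj.basicOpen 𝒜 (G a)),
      ∀ i, ⨆ a, X.basicOpen (S.coeff i a) = φ ⁻¹ᵁ Proj.basicOpen 𝒜 (G i) := by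
  -- coefficients `c i a := G_i/G_a` on `W a`, cocycle `g a b := (G_a/G_b)|` on `W a ⊓ W b`
  let W : Fin n → X.Opens := fun a => φ ⁻¹ᵁ Proj.basicOpen 𝒜 (G a)
  let c : Fin n → ∀ a : Fin n, Γ(X, W a) := fun i a => formHomRatio φ G hG hd a i
  let g : ∀ a b : Fin n, Γ(X, W a ⊓ W b) := fun a b =>
    X.presheaf.map (homOfLE (inf_le_right : W a ⊓ W b ≤ W b)).op (formHomRatio φ G hG hd b a)
  -- the cocycle identity `(G_a/G_b)(G_i/G_a) = G_i/G_b`, moved from `W b ⊓ W a` to `W a ⊓ W b`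
  have hrule : ∀ i a b, X.presheaf.map (homOfLE (inf_le_right : W a ⊓ W b ≤ W b)).op (c i b) =
      g a b * X.presheaf.map (homOfLE (inf_le_left : W a ⊓ W b ≤ W a)).op (c i a) := by
    intro i a b
    have h := formHomRatio_mul_formHomRatio φ G hG hd b a i
    have h' := congr_arg (X.presheaf.map (homOfLE (le_inf inf_le_right inf_le_left : W a ⊓ W b ≤ W b ⊓ W a)).op) h
    simp only [map_mul] at h'
    change X.presheaf.map _ (formHomRatio φ G hG hd b i) =
      X.presheaf.map _ (formHomRatio φ G hG hd b a) * X.presheaf.map _ (formHomRatio φ G hG hd a i)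
    rw [map_eq_map_map (inf_le_right (a := W a)).hom.op _ _ (formHomRatio φ G hG hd b i), ← h',
      map_map_irrel _ _ (homOfLE (inf_le_right : W a ⊓ W b ≤ W b)).op (𝟙 _) (formHomRatio φ G hG hd b a),
      map_map_irrel _ _ (homOfLE (inf_le_left : W a ⊓ W b ≤ W a)).op (𝟙 _) (formHomRatio φ G hG hd a i)]
    simp only [CategoryTheory.Functor.map_id]
    rfl
  have hunit : ∀ a b, IsUnit (g a b) := by
    intro a b
    -- `(G_a/G_b)| · (G_b/G_a)| = (G_b/G_b)| = 1`
    have h := formHomRatio_mul_formHomRatio φ G hG hd b a b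
    rw [formHomRatio_self, map_one] at h
    have h' := congr_arg (X.presheaf.map (homOfLE (le_inf inf_le_right inf_le_left : W a ⊓ W b ≤ W b ⊓ W a)).op) h
    rw [map_mul, map_one] at h'
    have e1 : g a b = X.presheaf.map (homOfLE (le_inf inf_le_right inf_le_left : W a ⊓ W b ≤ W b ⊓ W a)).op
        (X.presheaf.map (homOfLE (inf_le_left : W b ⊓ W a ≤ W b)).op (formHomRatio φ G hG hd b a)) :=
      map_eq_map_map _ _ _ _
    rw [e1]
    exact IsUnit.of_mul_eq_one _ h'
  refine ⟨CocycleSections.ofCocycle c g hrule hunit, fun i => ?_⟩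
  change ⨆ a, X.basicOpen (formHomRatio φ G hG hd a i) = _
  simp_rw [basicOpen_formHomRatio]
  change ⨆ a, W a ⊓ W i = W i
  rw [← iSup_inf_eq, hcov, top_inf_eq]

end CocycleOfForms

end UniversalFamilyQuasiProjective

end Literature.AlgebraicGeometry.ModuliOfAbelianVarieties

/-! ## §3 The piece: frame sections of `L^Δ(λ)^{⊗3}` over an affine open of the base, read on the total space -/

namespace Literature.AlgebraicGeometry.AbelianSchemes

namespace PolarizedAbelianSchemeWithLevel

open Literature.AlgebraicGeometry.ModuliOfAbelianVarieties

variable {g N : ℕ} {δ : Fin g → ℕ}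

/-- **THE PIECE.**  For a triple `Z` over a locally Noetherian `ℚ`-scheme `T`, `𝓜 := L^Δ(λ)^{⊗3}` framed on opens `W b` of
the total space `X` (`IF : IFrames 𝓜 W`, `⋃ W b = X`), a frame `𝒪^{m+1} ≅ (π_*𝓜)|_O` over an open `O` of `T` and an AFFINE open
`V ⊆ O`: there are coefficient functions `T k b ∈ Γ(X, W b ∩ U)` (`U` any name of `π⁻¹ V`), `k = 0, …, m`, with the
transition rule of ★ (G3) for the cocycle `IF.tfOn b' b`, AFFINE non-vanishing loci `⋃_b X_{T k b}`, and
`⋃_{k,b} X_{T k b} = U`.  Proof: the frame, pulled back along `V ↪ T` (★ `pullbackFrame`) and moved to `π_{V,*}(L^Δ(λ_V)^{⊗3})`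
(★ `pushforwardBaseChangeHom` for the open-immersion square, ★ `nonempty_pullback_tensorPow_iso_of_isBaseChangeVia`), is a
frame of the restricted triple `Z|_V`, which therefore embeds `X_V ↪ 𝐏^m × V` as a CLOSED subscheme (★ FS-b
`isClosedImmersion_pointOfSections_of_frame_LDelta_three`); over the affine `V` the loci of the frame sections are affine (★
`projectiveSpace.isAffineOpen_U_of_isClosedImmersion_pointOfSections`) and cover; ★
`exists_coeff_along_openImmersion_of_isAffineOpen` reads them on `X` along `X_V ↪ X`.
[cite: MumfordFogartyKirwan1994, Ch. 7 §2 Def. 7.5 (p. 130) and Prop. 7.6 (p. 136)]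
[cite: Hartshorne1977, II Lemma 5.14 (p. 118)] -/
theorem exists_coeff_of_frame_piece {T : Scheme.{0}} [IsLocallyNoetherian T] (πT : T ⟶ Spec (.of ℚ))
    (Z : PolarizedAbelianSchemeWithLevel g N δ T)
    (Gr : Z.A.X.left ⟶ Z.A.prodLeft Z.D.hat) (hGr₁ : Gr ≫ pullback.fst Z.A.X.hom Z.D.hat.X.hom = 𝟙 _)
    (hGr₂ : Gr ≫ pullback.snd Z.A.X.hom Z.D.hat.X.hom = Z.pol.lam.left)
    {β : Type} {W : β → Z.A.X.left.Opens}
    (IF : IFrames (tensorPow ((Scheme.Modules.pullback Gr).obj Z.D.P) 3) W) (hW : ⨆ b, W b = ⊤)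
    {O : T.Opens} {m : ℕ}
    (e : SheafOfModules.free (Fin (m + 1)) ≅
      ((Scheme.Modules.pushforward Z.A.X.hom).obj (tensorPow ((Scheme.Modules.pullback Gr).obj Z.D.P) 3)).over O)
    (V : T.Opens) (hV : IsAffineOpen V) (hVO : V ≤ O) (U : Z.A.X.left.Opens) (hU : Z.A.X.hom ⁻¹ᵁ V = U) :
    ∃ Tk : Fin (m + 1) → ∀ b : β, Γ(Z.A.X.left, W b ⊓ U),
      (∀ k b b', Z.A.X.left.presheaf.map (homOfLE (inf_le_right : (W b ⊓ U) ⊓ (W b' ⊓ U) ≤ W b' ⊓ U)).op (Tk k b') =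
          Z.A.X.left.presheaf.map (homOfLE (inf_le_inf inf_le_left inf_le_left :
              (W b ⊓ U) ⊓ (W b' ⊓ U) ≤ W b ⊓ W b')).op (IF.tfOn b' b (W b ⊓ W b') inf_le_right inf_le_left) *
            Z.A.X.left.presheaf.map (homOfLE (inf_le_left : (W b ⊓ U) ⊓ (W b' ⊓ U) ≤ W b ⊓ U)).op (Tk k b)) ∧
      (∀ k, IsAffineOpen (⨆ b, Z.A.X.left.basicOpen (Tk k b))) ∧ ⨆ k, ⨆ b, Z.A.X.left.basicOpen (Tk k b) = U := by
  classical
  haveI : IsProper Z.A.X.hom := Z.A.isProper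
  haveI : IsAffine (V : Scheme.{0}) := hV
  let 𝓜 : Z.A.X.left.Modules := tensorPow ((Scheme.Modules.pullback Gr).obj Z.D.P) 3
  -- the open piece `X_V ↪ X` and the restricted triple `Z|_V`
  let G : pullback Z.A.X.hom V.ι ⟶ Z.A.X.left := pullback.fst Z.A.X.hom V.ι
  have HV : IsPullback G (pullback.snd Z.A.X.hom V.ι) Z.A.X.hom V.ι := IsPullback.of_hasPullback _ _
  have hGU : G.opensRange = U := by
    rw [← hU, Scheme.Hom.opensRange_pullbackFst, Scheme.Opens.opensRange_ι]
  let ZV := Z.baseChange V.ι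
  let GrV : ZV.A.X.left ⟶ ZV.A.prodLeft ZV.D.hat :=
    pullback.lift (𝟙 _) ZV.pol.lam.left (by rw [Category.id_comp, ZV.pol.lam_comp_hom])
  have hGrV₁ : GrV ≫ pullback.fst ZV.A.X.hom ZV.D.hat.X.hom = 𝟙 _ := pullback.lift_fst _ _ _
  have hGrV₂ : GrV ≫ pullback.snd ZV.A.X.hom ZV.D.hat.X.hom = ZV.pol.lam.left := pullback.lift_snd _ _ _
  let 𝓜V : ZV.A.X.left.Modules := tensorPow ((Scheme.Modules.pullback GrV).obj ZV.D.P) 3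
  obtain ⟨φV⟩ := nonempty_pullback_tensorPow_iso_of_isBaseChangeVia (Z.baseChange_isBaseChangeVia V.ι)
    Gr hGr₁ hGr₂ GrV hGrV₁ hGrV₂ 3
  -- the frame of `π_{V,*} 𝓜_V` over `⊤`: pull `e` back along `V ↪ T`, then move along base change and `φV`
  haveI := isIso_pushforwardBaseChangeHom_of_isOpenImmersion HV 𝓜
  have hVO' : V.ι ⁻¹ᵁ O = ⊤ := top_le_iff.mp fun x _ => hVO x.2
  let χ : (Scheme.Modules.pullback V.ι).obj ((Scheme.Modules.pushforward Z.A.X.hom).obj 𝓜) ≅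
      (Scheme.Modules.pushforward ZV.A.X.hom).obj 𝓜V :=
    asIso (pushforwardBaseChangeHom HV.w 𝓜) ≪≫ (Scheme.Modules.pushforward (pullback.snd Z.A.X.hom V.ι)).mapIso φV
  let eV : SheafOfModules.free (Fin (Nat.card (Fin m) + 1)) ≅
      ((Scheme.Modules.pushforward ZV.A.X.hom).obj 𝓜V).over ⊤ :=
    (SheafOfModules.freeFunctor (R := (V : Scheme.{0}).ringCatSheaf.over ⊤)).mapIso
        (finCongr (by rw [Nat.card_eq_fintype_card, Fintype.card_fin])).toIso ≪≫
      SheafOfModules.restrictTrivialisation (R := (V : Scheme.{0}).ringCatSheaf) (eqToHom hVO'.symm)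
        (pullbackFrame V.ι e) ≪≫
      (SheafOfModules.overFunctor _ ⊤).mapIso χ
  -- the rank-one frame system of `𝓜_V` transported from `IF`
  have hWV : ⨆ b, G ⁻¹ᵁ W b = ⊤ := by
    rw [← Scheme.Hom.preimage_iSup, hW, Scheme.Hom.preimage_top]
  let FV : FrameSystem 𝓜V := ((IF.pullback G).mapIso φV).toFrameSystem hWV
  -- FS-b: the frame sections generate and embed `X_V ↪ 𝐏(Fin m; V)` as a closed subscheme
  obtain ⟨hcovV, himm⟩ := AbelianSchemeOver.Polarization.isClosedImmersion_pointOfSections_of_frame_LDelta_three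
    ZV.A ZV.D (V.ι ≫ πT) ZV.pol GrV hGrV₁ hGrV₂ FV (fun _ => rfl) (Fin m) eV
  -- affine loci over the affine `V`, and the cover, in the `coeffAt` currency
  have haffV : ∀ k, IsAffineOpen (⨆ y, ZV.A.X.left.basicOpen
      (coeffAt FV (fun _ => rfl) (fun j ↦ (basisSection eV j :)) k y)) := fun k =>
    projectiveSpace.isAffineOpen_U_of_isClosedImmersion_pointOfSections (Over.mk ZV.A.X.hom) _ himm k
  have hcovV' : ⨆ k, ⨆ y, ZV.A.X.left.basicOpen
      (coeffAt FV (fun _ => rfl) (fun j ↦ (basisSection eV j :)) k y) = ⊤ := hcovV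
  -- read on `X` along the open immersion `G`
  obtain ⟨Tk, hT, haff, hcov⟩ := exists_coeff_along_openImmersion_of_isAffineOpen G IF φV
    (fun j ↦ (basisSection eV j :)) hWV U hGU haffV hcovV'
  -- re-index `Fin (Nat.card (Fin m) + 1) ≃ Fin (m + 1)`
  let ε : Fin (m + 1) ≃ Fin (Nat.card (Fin m) + 1) := finCongr (by rw [Nat.card_eq_fintype_card, Fintype.card_fin])
  refine ⟨fun k => Tk (ε k), fun k b b' => hT (ε k) b b', fun k => haff (ε k), ?_⟩
  exact (Equiv.iSup_comp (g := fun k => ⨆ b, Z.A.X.left.basicOpen (Tk k b)) ε).trans hcov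

end PolarizedAbelianSchemeWithLevel

end Literature.AlgebraicGeometry.AbelianSchemes

/-! ## §4 The head and the `SiegelFineModuliScheme` corollaries -/

namespace Literature.AlgebraicGeometry.AbelianSchemes

namespace PolarizedAbelianSchemeWithLevel

open Literature.AlgebraicGeometry.ModuliOfAbelianVarieties
open Literature.AlgebraicGeometry.ModuliOfAbelianVarieties.UniversalFamilyQuasiProjective

variable {g N : ℕ} {δ : Fin g → ℕ}

/-- **THE TOTAL SPACE OF A POLARISED ABELIAN SCHEME (WITH LEVEL STRUCTURE) OVER A QUASI-PROJECTIVE LOCALLY NOETHERIAN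
`ℚ`-SCHEME IS QUASI-PROJECTIVE OVER `ℚ`** ([MumfordFogartyKirwan1994] Thm. 7.9: «the universal family over `A_{g,d,n}` is
quasi-projective»; [EGAII] Prop. 4.6.13 (ii): `L` `π`-ample and the base quasi-projective ⇒ `L ⊗ π^*𝒪(e)` ample).  Proof: §1–§3
feed the gluing lemma ★ `GeneratingSections.isQuasiProjectiveOver_of_affinePieces` with `𝓛 := π^* r^*𝒪(d)` (the forms `G_i`,
§2) and `𝓝 := L^Δ(λ)^{⊗3}` (framed by a rank-one frame system; on each piece `π⁻¹ M_{G_i}` the sections of a local frame of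
`π_*𝓝`, §3).  The binder `hδ` only supplies `6^g · ∏ δᵢ ≥ 1` (the frames are indexed by `Fin (m+1)`).
[cite: MumfordFogartyKirwan1994, Ch. 7 §3 Theorem 7.9 (p. 139)] [cite: EGAII, Prop. 4.6.13 (ii) and Prop. 5.3.4 (ii)]
[cite: Hartshorne1977, II Lemma 5.14 (p. 118) and II Thm. 7.6 (p. 154)] -/
theorem isQuasiProjectiveOver_total {M : SchemeOver ℚ} [IsLocallyNoetherian M.left]
    (Z : PolarizedAbelianSchemeWithLevel g N δ M.left) (hδ : IsPolarizationType δ) (hM : IsQuasiProjectiveOver M) :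
    IsQuasiProjectiveOver (Over.mk (Z.A.X.hom ≫ M.hom) : SchemeOver ℚ) := by
  classical
  haveI : IsProper Z.A.X.hom := Z.A.isProper
  haveI : Smooth Z.A.X.hom := Z.A.isSmooth
  -- `M` is compact, locally of finite type, immersed in `𝐏ⁿ_ℚ`
  have hqc : QuasiCompact M.hom := hM.isVarietyPair_ofScheme.quasiCompact
  haveI : LocallyOfFiniteType M.hom := hM.isVarietyPair_ofScheme.locallyOfFiniteType
  haveI : CompactSpace M.left := (quasiCompact_iff_compactSpace M.hom).mp hqc
  obtain ⟨P, j, ⟨n, ι, hι⟩, hj⟩ := hM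
  letI := MvPolynomial.gradedAlgebra (σ := Fin (n + 1)) (R := ℚ)
  set ιl : P.left ⟶ Proj (MvPolynomial.homogeneousSubmodule (Fin (n + 1)) ℚ) := ι.left with hιl
  haveI : IsClosedImmersion ιl := hι
  set jl : M.left ⟶ P.left := j.left with hjl
  haveI : IsOpenImmersion jl := hj
  set r : M.left ⟶ Proj (MvPolynomial.homogeneousSubmodule (Fin (n + 1)) ℚ) := jl ≫ ιl with hr
  haveI : IsImmersion r := inferInstance
  -- the total space is Noetherian and locally of finite type over `ℚ`
  haveI : IsLocallyNoetherian Z.A.X.left := LocallyOfFiniteType.isLocallyNoetherian Z.A.X.hom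
  haveI : CompactSpace Z.A.X.left := QuasiCompact.compactSpace_of_compactSpace Z.A.X.hom
  haveI : IsNoetherian Z.A.X.left := {}
  haveI : LocallyOfFiniteType (Over.mk (Z.A.X.hom ≫ M.hom) : SchemeOver ℚ).hom := by
    change LocallyOfFiniteType (Z.A.X.hom ≫ M.hom); infer_instance
  -- the bundle `𝓜 = L^Δ(λ)^{⊗3}`, its rank-one frames, and a frame system of `π_*𝓜` (rank `6^g d = m + 1`)
  let Gr : Z.A.X.left ⟶ Z.A.prodLeft Z.D.hat := pullback.lift (𝟙 _) Z.pol.lam.left (by rw [Category.id_comp, Z.pol.lam_comp_hom])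
  have hGr₁ : Gr ≫ pullback.fst Z.A.X.hom Z.D.hat.X.hom = 𝟙 _ := pullback.lift_fst _ _ _
  have hGr₂ : Gr ≫ pullback.snd Z.A.X.hom Z.D.hat.X.hom = Z.pol.lam.left := pullback.lift_snd _ _ _
  let 𝓜 : Z.A.X.left.Modules := tensorPow ((Scheme.Modules.pullback Gr).obj Z.D.P) 3
  obtain ⟨F, hF1⟩ := exists_frameSystem_of_hasRank (hasRank_tensorPow_one (hasRank_pullback Gr Z.D.hasRank_one) 3 : HasRank 𝓜 1)
  let IF : IFrames 𝓜 F.U :=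
    { frame := fun x => (SheafOfModules.freeFunctor (R := Z.A.X.left.ringCatSheaf.over (F.U x))).mapIso
        ((punitEnum.trans (finCongr (hF1 x).symm)).trans (F.enum x).symm).toIso ≪≫ F.frame x }
  have hWX : ⨆ x, F.U x = ⊤ := top_le_iff.mp fun x _ => Opens.mem_iSup.mpr ⟨x, F.mem x⟩
  obtain ⟨F₀, hF₀⟩ := exists_frameSystem_of_hasRank (Z.hasRank_pushforward_LDelta_three_of_compactSpace M.hom Gr hGr₁ hGr₂)
  have hd0 : 0 < 6 ^ g * polarizationDegree δ :=
    Nat.mul_pos (Nat.pow_pos (by norm_num)) (Finset.prod_pos fun i _ => hδ.1 i)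
  set m : ℕ := 6 ^ g * polarizationDegree δ - 1 with hm
  have hm1 : ∀ t, F₀.rank t = m + 1 := fun t => by rw [hF₀ t, hm]; omega
  let e : ∀ t, SheafOfModules.free (Fin (m + 1)) ≅
      ((Scheme.Modules.pushforward Z.A.X.hom).obj 𝓜).over (F₀.U t) := fun t =>
    (SheafOfModules.freeFunctor (R := M.left.ringCatSheaf.over (F₀.U t))).mapIso
        ((finCongr (hm1 t).symm).trans (F₀.enum t).symm).toIso ≪≫ F₀.frame t
  -- §1: forms `G_i` with affine `M_{G_i} ⊆ F₀.U (c i)` covering `M`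
  obtain ⟨n', d, Gf, c, hd, hGf, haffM, hleM, hcovM⟩ :=
    exists_forms_isAffineOpen_le_iSup_eq_top (MvPolynomial.homogeneousSubmodule (Fin (n + 1)) ℚ) r F₀.U F₀.mem
  -- §2: the forms as coefficient data on `Z.A.X.left`
  have hcovX : ⨆ a, (Z.A.X.hom ≫ r) ⁻¹ᵁ Proj.basicOpen (MvPolynomial.homogeneousSubmodule (Fin (n + 1)) ℚ) (Gf a) = ⊤ := by
    simp_rw [Scheme.Hom.comp_preimage]
    rw [← Scheme.Hom.preimage_iSup, hcovM, Scheme.Hom.preimage_top]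
  obtain ⟨S, hS⟩ := exists_cocycleSections_of_forms (MvPolynomial.homogeneousSubmodule (Fin (n + 1)) ℚ) (Z.A.X.hom ≫ r)
    Gf hGf hd hcovX
  -- §3 on every piece, with `U := ⨆ a, X_{S i a}` (the letter of (G3))
  have hUi : ∀ i, Z.A.X.hom ⁻¹ᵁ (r ⁻¹ᵁ Proj.basicOpen _ (Gf i)) = ⨆ a, Z.A.X.left.basicOpen (S.coeff i a) := fun i => by
    rw [hS i]; rfl
  choose Tk hT haff hcov using fun i =>
    Z.exists_coeff_of_frame_piece M.hom Gr hGr₁ hGr₂ IF hWX (e (c i)) _ (haffM i) (hleM i) _ (hUi i)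
  -- §4: the gluing lemma
  have hcovT : ⨆ i, ⨆ k, ⨆ b, Z.A.X.left.basicOpen (Tk i k b) = ⊤ := by
    rw [← hcovX]
    refine iSup_congr fun i => ?_
    rw [hcov i, ← hS i]
  haveI : IsNoetherian (Over.mk (Z.A.X.hom ≫ M.hom) : SchemeOver ℚ).left := by
    change IsNoetherian Z.A.X.left; infer_instance
  exact CocycleSections.isQuasiProjectiveOver_of_affinePieces (Z := (Over.mk (Z.A.X.hom ≫ M.hom) : SchemeOver ℚ)) F.U S
    (fun b b' => IF.tfOn b' b (F.U b ⊓ F.U b') inf_le_right inf_le_left) (fun b b' => IF.isUnit_tfOn_swap b b')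
    Tk hT haff hcovT

end PolarizedAbelianSchemeWithLevel

end Literature.AlgebraicGeometry.AbelianSchemes

namespace Literature.AlgebraicGeometry.ModuliOfAbelianVarieties

namespace SiegelFineModuliScheme

open Literature.AlgebraicGeometry.AbelianSchemes

variable {g N : ℕ} {δ : Fin g → ℕ} (𝓜 : SiegelFineModuliScheme g N δ)

/-- **(F-c″) FROM (F-c′): the total space of the universal abelian scheme over a quasi-projective fine Siegel moduli scheme is
quasi-projective over `ℚ`** ([MumfordFogartyKirwan1994] Thm. 7.9 «quasi-projective»; the hypothesis `hqpA` of ★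
`SiegelFineModuliSchemeLevelDescent` / ★ `SiegelUniversalFamilyPieceQuasiProjective.isQuasiProjectiveOver_univ_piece`).
[cite: MumfordFogartyKirwan1994, Ch. 7 §3 Theorem 7.9 (p. 139)] -/
theorem isQuasiProjectiveOver_univ (hδ : IsPolarizationType δ) (hqp : IsQuasiProjectiveOver 𝓜.M) :
    IsQuasiProjectiveOver (Over.mk (𝓜.univ.A.X.hom ≫ 𝓜.M.hom) : SchemeOver ℚ) :=
  haveI := 𝓜.isLocallyNoetherian
  𝓜.univ.isQuasiProjectiveOver_total hδ hqp

/-- **… and so is the total space of its DUAL** (★ `isQuasiProjectiveOver_univ_hat`: along the finite quasi-inverse of `λ`;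
over a reduced — e.g. smooth — carrier). [cite: MumfordFogartyKirwan1994, Ch. 7 §3 Theorem 7.9 (p. 139)]
[cite: MumfordAV1970, §7 Thm. 4 (p. 72)] -/
theorem isQuasiProjectiveOver_univ_and_hat [LocallyOfFiniteType 𝓜.M.hom] [IsReduced 𝓜.M.left]
    (hδ : IsPolarizationType δ) (hqp : IsQuasiProjectiveOver 𝓜.M) :
    IsQuasiProjectiveOver (Over.mk (𝓜.univ.A.X.hom ≫ 𝓜.M.hom) : SchemeOver ℚ) ∧
      IsQuasiProjectiveOver (Over.mk (𝓜.univ.D.hat.X.hom ≫ 𝓜.M.hom) : SchemeOver ℚ) :=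
  have hδ0 : ∏ i, δ i ≠ 0 := Finset.prod_ne_zero_iff.mpr fun i _ => (hδ.1 i).ne'
  ⟨𝓜.isQuasiProjectiveOver_univ hδ hqp, 𝓜.isQuasiProjectiveOver_univ_hat (𝓜.isQuasiProjectiveOver_univ hδ hqp) hδ0⟩

end SiegelFineModuliScheme

end Literature.AlgebraicGeometry.ModuliOfAbelianVarieties


/-! ## §6 (edition 2) Finitely many immersed quasi-compact pieces: forms of ONE common degree; compactness of immersed pieces -/

namespace Literature.AlgebraicGeometry.ModuliOfAbelianVarieties

namespace UniversalFamilyQuasiProjective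

section CommonDegree

variable {A : Type u} {σ : Type*} [CommRing A] [SetLike σ A] [AddSubgroupClass σ A] (𝒜 : ℕ → σ) [GradedRing 𝒜]

/-- **A scheme immersed in a quasi-compact locally Noetherian scheme is quasi-compact** (it is a subspace of a Noetherian
topological space; [GortzWedhorn2020] Lemma 1.25 / (3.17)): the slices of the covariant inherit quasi-compactness from it.
[cite: GortzWedhorn2020, Prop. 13.47 (pp. 392–393)] -/
theorem compactSpace_of_isImmersion {X Y : Scheme.{u}} (f : X ⟶ Y) [IsImmersion f] [IsLocallyNoetherian Y] [CompactSpace Y] :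
    CompactSpace X := by
  haveI : IsNoetherian Y := {}
  haveI : NoetherianSpace X := f.isEmbedding.isInducing.noetherianSpace
  infer_instance

/-- **Forms of ONE common positive degree, divisible by a prescribed `m > 0`, with AFFINE non-vanishing loci covering each of
finitely many quasi-compact schemes immersed in `Proj 𝒜`** (§1 piece by piece, then all forms raised to the common degree
`m · ∏ d_R` — `D₊(F^e) = D₊(F)`; [GortzWedhorn2020] Prop. 13.47 (i) ⇒ (iv) for the ample `r_R^*𝒪(1)`, uniformly in `R`).
[cite: GortzWedhorn2020, Prop. 13.47 (pp. 392–393)] -/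
theorem exists_forms_common_degree {ι' : Type} [Finite ι'] {Y : ι' → Scheme.{u}} (r : ∀ R, Y R ⟶ Proj 𝒜)
    [∀ R, IsImmersion (r R)] [∀ R, CompactSpace (Y R)] {m : ℕ} (hm : 0 < m) :
    ∃ (D : ℕ) (n : ι' → ℕ) (G : ∀ R, Fin (n R) → A), 0 < D ∧ m ∣ D ∧ (∀ R i, G R i ∈ 𝒜 D) ∧
      (∀ R i, IsAffineOpen (r R ⁻¹ᵁ Proj.basicOpen 𝒜 (G R i))) ∧ ∀ R, ⨆ i, r R ⁻¹ᵁ Proj.basicOpen 𝒜 (G R i) = ⊤ := by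
  classical
  haveI := Fintype.ofFinite ι'
  choose n d G c hd hG haff _ hcov using
    fun R => exists_forms_isAffineOpen_le_iSup_eq_top 𝒜 (r R) (fun _ => ⊤) (fun _ => trivial)
  set D : ℕ := m * ∏ R, d R with hD
  have hP0 : 0 < ∏ R, d R := Finset.prod_pos fun R _ ↦ hd R
  have hD0 : 0 < D := Nat.mul_pos hm hP0
  have hdvd : ∀ R, d R ∣ D := fun R ↦ (Finset.dvd_prod_of_mem d (Finset.mem_univ R)).mul_left m
  have hpow : ∀ R i, Proj.basicOpen 𝒜 (G R i ^ (D / d R)) = Proj.basicOpen 𝒜 (G R i) := fun R i =>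
    Proj.basicOpen_pow 𝒜 _ _ (Nat.div_pos (Nat.le_of_dvd hD0 (hdvd R)) (hd R))
  refine ⟨D, n, fun R i ↦ G R i ^ (D / d R), hD0, Dvd.intro _ rfl, fun R i ↦ ?_, fun R i ↦ ?_, fun R => ?_⟩
  · have h := SetLike.pow_mem_graded (D / d R) (hG R i)
    rwa [smul_eq_mul, Nat.div_mul_cancel (hdvd R)] at h
  · rw [hpow]; exact haff R i
  · simp_rw [hpow]; exact hcov R

end CommonDegree

end UniversalFamilyQuasiProjective

end Literature.AlgebraicGeometry.ModuliOfAbelianVarieties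

end
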